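import Summits.BirchSwinnertonDyer.BirchSwinnertonDyer.Theorems.PrintX11aMultThreeOrbitKernel
import Summits.BirchSwinnertonDyer.BirchSwinnertonDyer.Theorems.PrintX11aMultThreeAtkinLehnerPeriods
import Summits.BirchSwinnertonDyer.BirchSwinnertonDyer.Theorems.PrintX8VerticalStevensIrreducible
import Literature.NumberTheory.EllipticCurves.PlusSymbolBoundOddMultiplicativeProofs
import Literature.NumberTheory.EllipticCurves.AtkinLehnerInvolutionsProofs
import Literature.NumberTheory.EllipticCurves.PAdicLFunctionInterpolationProofs
import HarnessLib

/-!
# Route `PrintX11a`, crux U3 `UpperNonSurjThree` (item stmt-BirchSwinnertonDyer-20613), line finemu3 — μ-road stub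
# `stub_muAnHardThree`: THE WINDING THEOREM AT MULTIPLICATIVE `3` — a unit plus symbol `[u/3ᵏ]⁺_f` exists

Cell `bsd-print-x11a`, width seat bsd-line-x11a-p2 g2 (`--supports stmt-BirchSwinnertonDyer-20613 --as helper`). Theorems
only; no definition, no named fact, no `sorry`. BSD is not proved by any of this; nothing is asserted about any specific curve.

**`exists_one_le_norm_ratPlusSymbol_div_three_pow`.** For every elliptic curve `E = W/ℚ` (globally minimal model) with
MULTIPLICATIVE reduction at `3` and `E[3]` IRREDUCIBLE, and every newform `f` of `W` (level `N = 3M`, `3 ∤ M`): some plus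
symbol `[u/3ᵏ]⁺_f` with `k ≥ 1`, `3 ∤ u` — a value (up to the sign `a₃ᵏ`) of the Mazur–Tate–Teitelbaum measure on
`ℤ₃^×` — has `3`-adic norm `≥ 1`.  This is the multiplicative-`3` analogue of the tree's input-free non-constancy theorem
at good `3` (`PrintX8VerticalStevens.cycWindingNonConstancyOddIrreducible_of_conjSpanGenAll` + THEOREM B), where the span
statement THEOREM B (`ConjSpanGen`, vacuous at `3 ∣ N`) is replaced by the ATKIN–LEHNER-EXTENDED ORBIT TRICK
(`MultThreeOrbit.mem_of_orbitTrick`, files `…MultThreeOrbit{Defs,Decomposition,Kernel}`), fed by the period relations of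
`…MultThreeAtkinLehnerPeriods`:

* the period datum: `m γ := [γ·0]⁺_f − [0]⁺_f = re{∞, γ∞}_f/Ω⁺_f` (Manin), `σ := −a₃(f)` (the `w₃`-eigenvalue, tree
  theorem `IsNewform0.atkinLehnerInvolution_eq_smul_of_not_dvd`), `γ₀ = W²/3`, `κ := m γ₀ / 2`,
  `Z := {q : ‖q‖₃ < 1}`; `W`-equivariance `m(γ^W) = σ m(γ)` and `m γ₀ = (1 + σ)([y/3]⁺ − [0]⁺)` are (i)/(ii) of the
  sibling file;
* the three local hypotheses of the kernel theorem follow from the NEGATION of the goal («every `[u/3ᵏ]⁺`, `k ≥ 1`,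
  `3 ∤ u`, is a non-unit») together with `[0]⁺ = −[1/3]⁺` at non-split `3` (the `U₃`-relation
  `intCast_mul_ratPlusSymbol_of_dvd`, evenness and periodicity of `[·]⁺`);
* hence `3 ∣ m` on `Γ₁(N)` — impossible by the Hecke bridge `exists_mem_one_le_norm_sub_of_spanModBy_of_prime` at a good
  prime `ℓ` with `a_ℓ(E) ≢ ℓ + 1 (mod 3)` (`E[3]` irreducible: `not_irreducible_of_frobeniusTrace_congr_holds`).
Consumed by `…UpperNonSurjThreeMuAnHardThreeOfMazur` (`μ^an = 0` at multiplicative `3`, the stub).  beyond-print: yes —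
Greenberg's analytic `μ₃ = 0` at multiplicative `3` for residually irreducible `E` is not in print.
References: [Manin1972] Prop. 1.4, Thm. 1.6; [MazurTateTeitelbaum1986Invent] §I.4 (4.2), §I.8, §I.10, §I.17;
[Vaserstein1972SL2] Theorem; [Knapp1993] Lemma 9.24, Thm. 9.27; [GreenbergLNM1716] Conj. 1.11.
-/

set_option linter.dupNamespace false
set_option autoImplicit false

namespace Summit.BirchSwinnertonDyer.BirchSwinnertonDyer.Theorems.MultThreeWinding

open scoped MatrixGroups ModularForm
open CongruenceSubgroup Matrix.SpecialLinearGroup WeierstrassCurve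
  Literature.NumberTheory.EllipticCurves Literature.NumberTheory.EllipticCurves.ModularForms
  Literature.NumberTheory.EllipticCurves.Rank1Residual
  Summit.BirchSwinnertonDyer.BirchSwinnertonDyer.Theorems.MultThreeOrbit
  Summit.BirchSwinnertonDyer.BirchSwinnertonDyer.Theorems.MultThreeAL

noncomputable section

variable {N : ℕ} [NeZero N] {f : CuspForm (Gamma0 N) 2}

/-- `[r]⁺_f = re{∞, r}_f / Ω⁺_f` for a rational real-coefficient `f`. [cite: MazurTateTeitelbaum1986Invent, §I.8] -/
theorem ratCast_ratPlusSymbol_eq_re_div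
    (hrat : ∀ r : ℚ, (ratPlusSymbol f r : ℝ) = normalizedPlusSymbol f r)
    (hreal : ∀ n, (cuspCoeff f n).im = 0) (r : ℚ) :
    (ratPlusSymbol f r : ℝ) = (modularSymbol f r).re / plusPeriod f := by
  rw [hrat, normalizedPlusSymbol, plusSymbol_eq_re_holds f hreal, Complex.ofReal_re]

/-- The period value `[b/d]⁺_f − [0]⁺_f` of `γ = (a b; c d) ∈ Γ₀(N)` (`d ≠ 0`) is `re{∞, γ∞}_f / Ω⁺_f`.
[cite: Manin1972, Prop. 1.4] -/
theorem ratCast_periodValue_eq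
    (hrat : ∀ r : ℚ, (ratPlusSymbol f r : ℝ) = normalizedPlusSymbol f r)
    (hreal : ∀ n, (cuspCoeff f n).im = 0) (γ : Gamma0 N) (hd : ((γ : SL(2, ℤ)) 1 1 : ℤ) ≠ 0) :
    ((ratPlusSymbol f ((((γ : SL(2, ℤ)) 0 1 : ℤ) : ℚ) / (((γ : SL(2, ℤ)) 1 1 : ℤ) : ℚ)) -
        ratPlusSymbol f 0 : ℚ) : ℝ) = (cuspSymbol f γ).re / plusPeriod f := by
  have hd0 : ((γ : SL(2, ℤ)) 1 1 : ℚ) ≠ 0 := by exact_mod_cast hd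
  have h := PrintX8VerticalStevens.ratCast_ratPlusSymbol_moebius_sub f hrat hreal γ 0 (by simpa using hd0)
  simp only [mul_zero, zero_add] at h
  push_cast
  exact h

/-- Base-point independence: `[γ r]⁺_f − [r]⁺_f = [γ 0]⁺_f − [0]⁺_f` (`c r + d ≠ 0`, `d ≠ 0`).
[cite: Manin1972, Prop. 1.4] -/
theorem periodValue_eq_sub
    (hrat : ∀ r : ℚ, (ratPlusSymbol f r : ℝ) = normalizedPlusSymbol f r)
    (hreal : ∀ n, (cuspCoeff f n).im = 0) (γ : Gamma0 N) (hd : ((γ : SL(2, ℤ)) 1 1 : ℤ) ≠ 0)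
    (r : ℚ) (hr : ((γ : SL(2, ℤ)) 1 0 : ℚ) * r + ((γ : SL(2, ℤ)) 1 1 : ℚ) ≠ 0) :
    ratPlusSymbol f ((((γ : SL(2, ℤ)) 0 1 : ℤ) : ℚ) / (((γ : SL(2, ℤ)) 1 1 : ℤ) : ℚ)) - ratPlusSymbol f 0 =
      ratPlusSymbol f ((((γ : SL(2, ℤ)) 0 0 : ℚ) * r + ((γ : SL(2, ℤ)) 0 1 : ℚ)) /
        (((γ : SL(2, ℤ)) 1 0 : ℚ) * r + ((γ : SL(2, ℤ)) 1 1 : ℚ))) - ratPlusSymbol f r := by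
  have h1 := ratCast_periodValue_eq hrat hreal γ hd
  have h2 := PrintX8VerticalStevens.ratCast_ratPlusSymbol_moebius_sub f hrat hreal γ r hr
  have : ((ratPlusSymbol f ((((γ : SL(2, ℤ)) 0 1 : ℤ) : ℚ) / (((γ : SL(2, ℤ)) 1 1 : ℤ) : ℚ)) -
      ratPlusSymbol f 0 : ℚ) : ℝ) = ((ratPlusSymbol f ((((γ : SL(2, ℤ)) 0 0 : ℚ) * r + ((γ : SL(2, ℤ)) 0 1 : ℚ)) /
        (((γ : SL(2, ℤ)) 1 0 : ℚ) * r + ((γ : SL(2, ℤ)) 1 1 : ℚ))) - ratPlusSymbol f r : ℚ) : ℝ) := by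
    rw [h1]; push_cast; rw [h2]
  exact_mod_cast this

/-- **THE WINDING THEOREM AT MULTIPLICATIVE `3`.** For an elliptic curve `E = W/ℚ` (globally minimal model) with
MULTIPLICATIVE reduction at `3` and `E[3]` IRREDUCIBLE, and every newform `f` of `W`: SOME plus symbol
`[u/3ᵏ]⁺_f` (`k ≥ 1`, `3 ∤ u`) — a value of the Mazur–Tate–Teitelbaum measure on `ℤ₃^×` — is a `3`-adic unit
(norm `≥ 1`).  Proof: if all were non-units, the period datum `m γ = [γ0]⁺ − [0]⁺`, `σ = −a₃`, `Z = {‖·‖₃ < 1}`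
satisfies the hypotheses of the kernel theorem `MultThreeOrbit.mem_of_orbitTrick` (Atkin–Lehner-extended orbit trick
in `GL₂(ℤ[1/3])`: (i)/(ii) of `…MultThreeAtkinLehnerPeriods`, `[0]⁺ = −[1/3]⁺` at non-split `3` by the `U₃`-relation),
so `3 ∣ m` on `Γ₁(N)`, contradicting the Hecke bridge `exists_mem_one_le_norm_sub_of_spanModBy_of_prime` at a good
prime `ℓ` with `a_ℓ ≢ ℓ + 1 (mod 3)` (which exists since `E[3]` is irreducible).  No named fact is used.
[cite: Manin1972, Prop. 1.4, Thm. 1.6] [cite: MazurTateTeitelbaum1986Invent, §I.4 (4.2), §I.10]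
[cite: Vaserstein1972SL2, Theorem, p. 313] [cite: Knapp1993, Lemma 9.24, Thm. 9.27] -/
theorem exists_one_le_norm_ratPlusSymbol_div_three_pow
    (W : WeierstrassCurve ℚ) [W.IsElliptic] [W.IsGloballyMinimal]
    (hmult : W.HasMultiplicativeReductionAtPrime 3) (hirr : W.HasIrreducibleModPGaloisRep 3)
    (hf : IsNewformOf W f) :
    ∃ (k : ℕ) (u : ℤ), 1 ≤ k ∧ ¬ (3 : ℤ) ∣ u ∧
      1 ≤ ‖((ratPlusSymbol f ((u : ℚ) / (3 : ℚ) ^ k) : ℚ) : ℚ_[3])‖ := by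
  haveI h3p : Fact (Nat.Prime 3) := ⟨Nat.prime_three⟩
  by_contra H
  push Not at H
  -- H : ∀ k u, 1 ≤ k → ¬ 3 ∣ u → ‖[u/3^k]⁺‖ < 1
  -- ### rationality / reality of the symbols
  have hQ : coeffField f = ⊥ := hf.coeffField_eq_bot
  have hrat : ∀ r : ℚ, (ratPlusSymbol f r : ℝ) = normalizedPlusSymbol f r :=
    fun r ↦ ratCast_ratPlusSymbol_holds hf.1 hQ r
  have hreal : ∀ n, (cuspCoeff f n).im = 0 := cuspCoeff_im_eq_zero_of_coeffField_eq_bot hQ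
  have hΩpos : 0 < plusPeriod f := (plusPeriod_pos_and_realPeriods_eq isZLattice_periodLattice_holds hf.1 hQ).1
  have hΩ : plusPeriod f ≠ 0 := hΩpos.ne'
  -- ### the level `N = 3M`, `3 ∤ M`, and `a₃ = ±1`
  obtain ⟨h3N, h9N, a3, ha3, ha3'⟩ := hf.dvd_level_and_not_sq_dvd_of_multiplicative hmult
  set M : ℕ := N / 3 with hMdef
  have hNM : N = 3 * M := (Nat.mul_div_cancel' h3N).symm
  have h3M : ¬ 3 ∣ M := by
    rintro ⟨t, ht⟩
    exact h9N ⟨t, by rw [hNM, ht]; ring⟩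
  have hM : 0 < M := Nat.pos_of_ne_zero (by rintro h0; exact NeZero.ne N (by simp [hNM, h0]))
  have hc : Nat.Coprime 3 (N / 3) := (Nat.Prime.coprime_iff_not_dvd Nat.prime_three).mpr h3M
  -- ### the Atkin–Lehner data: `W = (3x, y; 3M, 3)`, `3x − My = 1`, `ε = −a₃`
  set x : ℤ := (atkinLehnerSL N 3 : SL(2, ℤ)) 0 0 with hx
  set y : ℤ := (atkinLehnerSL N 3 : SL(2, ℤ)) 0 1 with hy
  have hbez : 3 * x - (M : ℤ) * y = 1 := by
    have := atkinLehnerSL_bezout N 3 hc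
    rw [hx, hy]; exact_mod_cast this
  set σ : ℤ := -a3 with hσdef
  have hσ : σ = 1 ∨ σ = -1 := by rcases ha3' with h | h <;> simp [hσdef, h]
  set ε : ℂ := (σ : ℂ) with hεdef
  have hε1 : ε ^ 2 = 1 := by rcases hσ with h | h <;> simp [hεdef, h]
  have hε : atkinLehnerInvolution N 2 3 f = ε • f := by
    have h := IsNewform0.atkinLehnerInvolution_eq_smul_of_not_dvd (N := N) (k := 2) (p := 3) hNM h3M hf.1
    rw [h]
    congr 1
    have h1 : (((3 : ℕ) : ℝ) ^ (1 - ((2 : ℤ) : ℝ) / 2) : ℝ) = 1 := by norm_num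
    have h2 : (PowerSeries.coeff 3) (UpperHalfPlane.qExpansion 1 ⇑f) = (a3 : ℂ) := ha3
    simp only [h1, h2, hεdef, hσdef]; push_cast; ring
  -- ### the period datum `m`, the subgroup `Z`
  set m : Gamma0 N → ℚ := fun γ ↦
    ratPlusSymbol f ((((γ : SL(2, ℤ)) 0 1 : ℤ) : ℚ) / (((γ : SL(2, ℤ)) 1 1 : ℤ) : ℚ)) - ratPlusSymbol f 0
    with hmdef
  let Z : AddSubgroup ℚ :=
    { carrier := {q | ‖((q : ℚ) : ℚ_[3])‖ < 1}
      add_mem' := by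
        intro a b ha hb
        simp only [Set.mem_setOf_eq] at ha hb ⊢
        push_cast
        exact lt_of_le_of_lt (Padic.nonarchimedean _ _) (max_lt ha hb)
      zero_mem' := by simp
      neg_mem' := by
        intro a ha
        simp only [Set.mem_setOf_eq] at ha ⊢
        push_cast; rwa [norm_neg] }
  have hZ : ∀ q : ℚ, q ∈ Z ↔ ‖((q : ℚ) : ℚ_[3])‖ < 1 := fun q ↦ Iff.rfl
  have hd0 : ∀ γ : Gamma0 N, ((γ : SL(2, ℤ)) 1 1 : ℤ) ≠ 0 := fun γ h ↦
    not_three_dvd_d hNM γ (by rw [h]; exact dvd_zero 3)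
  have hm_cast : ∀ γ : Gamma0 N, (m γ : ℝ) = (cuspSymbol f γ).re / plusPeriod f :=
    fun γ ↦ ratCast_periodValue_eq hrat hreal γ (hd0 γ)
  have hm_mul : ∀ γ γ' : Gamma0 N, m (γ * γ') = m γ + m γ' := by
    intro γ γ'
    have : ((m (γ * γ') : ℚ) : ℝ) = ((m γ + m γ' : ℚ) : ℝ) := by
      push_cast
      rw [hm_cast, hm_cast, hm_cast, cuspSymbol_mul_holds f, Complex.add_re, add_div]
    exact_mod_cast this
  have hm_conj : ∀ γ γ' : Gamma0 N, ((γ' : SL(2, ℤ)) : Matrix (Fin 2) (Fin 2) ℤ) * Wint M x y =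
      Wint M x y * ((γ : SL(2, ℤ)) : Matrix (Fin 2) (Fin 2) ℤ) → m γ' = σ * m γ := by
    intro γ γ' hconj
    have h := cuspSymbol_eq_mul_of_conj_alWInt h3N hc hε γ γ' hconj
    have : ((m γ' : ℚ) : ℝ) = ((σ * m γ : ℚ) : ℝ) := by
      push_cast
      rw [hm_cast, hm_cast, h, hεdef]
      simp [Complex.mul_re]
      ring
    exact_mod_cast this
  obtain ⟨γ₀, hsq⟩ := exists_sq_alWInt (N := N) h3N hc
  have hii := cuspSymbol_eq_of_sq_alWInt h3N hc hε hε1 γ₀ hsq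
  -- `m γ₀ = (1 + σ)([y/3]⁺ − [0]⁺)`
  have hmγ₀ : m γ₀ = (1 + σ) * (ratPlusSymbol f ((y : ℚ) / 3) - ratPlusSymbol f 0) := by
    have : ((m γ₀ : ℚ) : ℝ) = (((1 + σ) * (ratPlusSymbol f ((y : ℚ) / 3) - ratPlusSymbol f 0) : ℚ) : ℝ) := by
      push_cast
      rw [hm_cast, hii, ratCast_ratPlusSymbol_eq_re_div hrat hreal, ratCast_ratPlusSymbol_eq_re_div hrat hreal,
        hεdef]
      have : (((y : ℚ) / 3 : ℚ)) = (((atkinLehnerSL N 3 : SL(2, ℤ)) 0 1 : ℚ) / 3) := by rw [hy]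
      rw [this]
      simp [Complex.mul_re, Complex.sub_re]
      ring
    exact_mod_cast this
  set κ : ℚ := m γ₀ / 2 with hκdef
  have hκ : (1 + σ) * κ = m γ₀ := by
    rcases hσ with h | h
    · rw [hκdef, h]; ring
    · rw [hκdef, hmγ₀, h]; ring
  have hconjex : ∀ γ : Gamma0 N, ∃ γ' : Gamma0 N,
      ((γ' : SL(2, ℤ)) : Matrix (Fin 2) (Fin 2) ℤ) * Wint M x y =
        Wint M x y * ((γ : SL(2, ℤ)) : Matrix (Fin 2) (Fin 2) ℤ) :=
    fun γ ↦ exists_conj_alWInt (N := N) h3N hc γ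
  -- ### the three local smallness hypotheses
  have h3y : ¬ (3 : ℤ) ∣ y := not_three_dvd_y hbez
  have h_b0 : ∀ γ : Gamma0 N, (γ : SL(2, ℤ)) 0 1 = 0 → m γ ∈ Z := by
    intro γ hb
    rw [hZ]
    have : m γ = 0 := by simp only [hmdef, hb, Int.cast_zero, zero_div, sub_self]
    rw [this]; simp
  have hper : ∀ (r : ℚ) (n : ℤ), ratPlusSymbol f (r + n) = ratPlusSymbol f r :=
    fun r n ↦ ratPlusSymbol_add_intCast_holds (f := f) r n
  have h_d1 : ∀ γ : Gamma0 N, ((γ : SL(2, ℤ)) 1 1 = 1 ∨ (γ : SL(2, ℤ)) 1 1 = -1) → m γ ∈ Z := by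
    intro γ hd
    rw [hZ]
    have : m γ = 0 := by
      rcases hd with h | h
      · simp only [hmdef, h, Int.cast_one, div_one]
        rw [← zero_add ((((γ : SL(2, ℤ)) 0 1 : ℤ) : ℚ)), hper, sub_self]
      · simp only [hmdef, h, Int.cast_neg, Int.cast_one, div_neg, div_one]
        rw [← Int.cast_neg, ← zero_add (((-((γ : SL(2, ℤ)) 0 1) : ℤ) : ℚ)), hper, sub_self]
    rw [this]; simp
  -- `[0]⁺` is small when `σ = 1` (non-split: `a₃ = −1`, the `U₃`-relation gives `[0]⁺ = −[1/3]⁺`)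
  have hsmall13 : ‖((ratPlusSymbol f ((1 : ℚ) / 3) : ℚ) : ℚ_[3])‖ < 1 := by
    have := H 1 1 le_rfl (by norm_num)
    simpa using this
  have h0small : σ = 1 → ‖((ratPlusSymbol f 0 : ℚ) : ℚ_[3])‖ < 1 := by
    intro hσ1
    have ha3m : a3 = -1 := by rw [hσdef] at hσ1; omega
    have hU := intCast_mul_ratPlusSymbol_of_dvd 3 hf.1 Nat.prime_three h3N ha3 hrat 0
    rw [Fin.sum_univ_three] at hU
    simp only [Fin.val_zero, Fin.val_one, Fin.val_two, CharP.cast_eq_zero, zero_add, Nat.cast_one,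
      Nat.cast_ofNat, zero_div] at hU
    have h23 : ratPlusSymbol f ((2 : ℚ) / 3) = ratPlusSymbol f ((1 : ℚ) / 3) := by
      rw [show ((2 : ℚ) / 3) = -((1 : ℚ) / 3) + (1 : ℤ) by norm_num, hper, ratPlusSymbol_neg]
    rw [h23, ha3m] at hU
    have h0 : ratPlusSymbol f 0 = -ratPlusSymbol f ((1 : ℚ) / 3) := by
      push_cast at hU; linarith
    rw [h0]; push_cast; rw [norm_neg]; exact hsmall13
  have hysmall : ‖((ratPlusSymbol f ((y : ℚ) / 3) : ℚ) : ℚ_[3])‖ < 1 := by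
    have := H 1 y le_rfl h3y
    simpa using this
  have h_W : ∀ γ : Gamma0 N,
      (∃ e : ℕ, 1 ≤ e ∧ ((γ : SL(2, ℤ)) 1 0 * y + (γ : SL(2, ℤ)) 1 1 * 3 : ℤ).natAbs = 3 ^ e) →
        m γ + κ ∈ Z := by
    rintro γ ⟨e, he1, he⟩
    set a : ℤ := (γ : SL(2, ℤ)) 0 0 with ha
    set b : ℤ := (γ : SL(2, ℤ)) 0 1 with hb
    set c : ℤ := (γ : SL(2, ℤ)) 1 0 with hcc
    set d : ℤ := (γ : SL(2, ℤ)) 1 1 with hdd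
    have hD0 : (c * y + d * 3 : ℤ) ≠ 0 := by
      intro h0; rw [h0, Int.natAbs_zero] at he; exact (pow_ne_zero e (by norm_num : (3 : ℕ) ≠ 0)) he.symm
    -- `m γ = [γ(y/3)]⁺ − [y/3]⁺`
    have hr : (c : ℚ) * ((y : ℚ) / 3) + (d : ℚ) ≠ 0 := by
      intro h0
      apply hD0
      have : ((c * y + d * 3 : ℤ) : ℚ) = 3 * ((c : ℚ) * ((y : ℚ) / 3) + (d : ℚ)) := by push_cast; ring
      exact_mod_cast (show ((c * y + d * 3 : ℤ) : ℚ) = 0 by rw [this, h0, mul_zero])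
    have hmγ : m γ = ratPlusSymbol f (((a : ℚ) * ((y : ℚ) / 3) + (b : ℚ)) / ((c : ℚ) * ((y : ℚ) / 3) + (d : ℚ))) -
        ratPlusSymbol f ((y : ℚ) / 3) := periodValue_eq_sub hrat hreal γ (hd0 γ) _ hr
    -- the cusp `γ(y/3) = u/3ᵉ` with `3 ∤ u`
    have h3c : (3 : ℤ) ∣ c := dvd_trans ⟨(M : ℤ), by rw [hNM]; push_cast; ring⟩ (dvd_of_mem_Gamma0 γ.2)
    have h3num : ¬ (3 : ℤ) ∣ a * y + b * 3 := by
      intro h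
      have h3a : (3 : ℤ) ∣ a := by
        have : (3 : ℤ) ∣ a * y := by simpa using dvd_sub h (dvd_mul_left 3 b)
        exact (Int.prime_three.dvd_or_dvd this).resolve_right h3y
      have hdet := Matrix.SpecialLinearGroup.det_coe (γ : SL(2, ℤ))
      rw [Matrix.det_fin_two] at hdet
      have : (3 : ℤ) ∣ 1 := by
        rw [← hdet]; exact dvd_sub (dvd_mul_of_dvd_left h3a _) (dvd_mul_of_dvd_right h3c _)
      omega
    obtain ⟨u, hu3, hval⟩ : ∃ u : ℤ, ¬ (3 : ℤ) ∣ u ∧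
        ((a : ℚ) * ((y : ℚ) / 3) + (b : ℚ)) / ((c : ℚ) * ((y : ℚ) / 3) + (d : ℚ)) = (u : ℚ) / (3 : ℚ) ^ e := by
      have hq : ((a : ℚ) * ((y : ℚ) / 3) + (b : ℚ)) / ((c : ℚ) * ((y : ℚ) / 3) + (d : ℚ)) =
          ((a * y + b * 3 : ℤ) : ℚ) / ((c * y + d * 3 : ℤ) : ℚ) := by
        have hD0' : ((c * y + d * 3 : ℤ) : ℚ) ≠ 0 := by exact_mod_cast hD0
        rw [div_eq_div_iff hr hD0']; push_cast; ring
      rcases Int.natAbs_eq (c * y + d * 3) with hs | hs <;> rw [he] at hs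
      · refine ⟨a * y + b * 3, h3num, ?_⟩
        rw [hq, hs]; push_cast; ring
      · refine ⟨-(a * y + b * 3), by rwa [dvd_neg], ?_⟩
        rw [hq, hs]; push_cast; ring
    rw [hmγ, hval, hZ]
    rcases hσ with hσ1 | hσm
    · -- `σ = 1`: `κ = [y/3]⁺ − [0]⁺`, value `[u/3ᵉ]⁺ − [0]⁺`
      have hκ1 : κ = ratPlusSymbol f ((y : ℚ) / 3) - ratPlusSymbol f 0 := by
        rw [hκdef, hmγ₀, hσ1]; ring
      rw [hκ1, show ratPlusSymbol f ((u : ℚ) / 3 ^ e) - ratPlusSymbol f ((y : ℚ) / 3) +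
        (ratPlusSymbol f ((y : ℚ) / 3) - ratPlusSymbol f 0) =
          ratPlusSymbol f ((u : ℚ) / 3 ^ e) - ratPlusSymbol f 0 by ring]
      push_cast
      rw [sub_eq_add_neg]
      refine lt_of_le_of_lt (Padic.nonarchimedean _ _) (max_lt (H e u he1 hu3) ?_)
      rw [norm_neg]; exact h0small hσ1
    · -- `σ = −1`: `κ = 0`, value `[u/3ᵉ]⁺ − [y/3]⁺`
      have hκ0 : κ = 0 := by rw [hκdef, hmγ₀, hσm]; ring
      rw [hκ0, add_zero]
      push_cast
      rw [sub_eq_add_neg]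
      refine lt_of_le_of_lt (Padic.nonarchimedean _ _) (max_lt (H e u he1 hu3) ?_)
      rw [norm_neg]; exact hysmall
  -- ### the kernel theorem on `Γ₁(N)`
  have hkernel : ∀ γ : Gamma0 N, γ ∈ Gamma1' N → m γ ∈ Z := by
    intro γ hγ1
    have hγM : (γ : SL(2, ℤ)) ∈ Gamma0 M :=
      mem_Gamma0_of_dvd (dvd_trans ⟨(3 : ℤ), by rw [hNM]; push_cast; ring⟩ (dvd_of_mem_Gamma0 γ.2))
    have hd1 : ((((γ : SL(2, ℤ)) 1 1 : ℤ)) : ZMod M) = 1 := by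
      have h1 : ((((γ : SL(2, ℤ)) 1 1 : ℤ)) : ZMod N) = 1 := Gamma1_mem'.mp hγ1
      have hMN : M ∣ N := ⟨3, by rw [hNM]; ring⟩
      have := congrArg (ZMod.castHom hMN (ZMod M)) h1
      rwa [map_intCast, map_one] at this
    exact mem_of_orbitTrick hbez hNM h3M hM Z m σ κ γ₀ hσ hm_mul hm_conj hsq hκ hconjex h_b0 h_d1 h_W γ
      ⟨(γ : SL(2, ℤ)), hγM⟩ rfl ⟨0, Or.inl (by simpa [dEntry] using hd1)⟩
  -- ### the Hecke bridge at a good prime `ℓ` with `a_ℓ ≢ ℓ + 1 (mod 3)`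
  obtain ⟨ℓ, hℓinst, -, hgoodℓ, hℓ1⟩ :=
    exists_prime_not_dvd_frobeniusTrace_sub not_irreducible_of_frobeniusTrace_congr_holds W 3 hirr
  haveI := hℓinst
  have hℓN : ¬ ℓ ∣ N := not_dvd_level_of_isNewformOf hf hgoodℓ
  set S : Set (Gamma0 N) := {γ | ‖((ratPlusSymbol f ((((γ : SL(2, ℤ)) 0 1 : ℤ) : ℚ) /
    (((γ : SL(2, ℤ)) 1 1 : ℤ) : ℚ)) - ratPlusSymbol f 0 : ℚ) : ℚ_[3])‖ < 1} with hSdef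
  have hS : SpanModBy N 3 S := fun γ hγ ↦
    Subgroup.mem_sup_left (Subgroup.subset_closure (Or.inl (Or.inl (hkernel γ hγ))))
  obtain ⟨γ, hγS, hge⟩ := PrintX8VerticalStevens.exists_mem_one_le_norm_sub_of_spanModBy_of_prime hf.1 hQ
    (p := 3) (by norm_num) hℓN (cuspCoeff_eq_frobeniusTrace_of_isNewformOf_holds hf hgoodℓ) hℓ1 S hS
  exact absurd hge (not_le.mpr hγS)

end

end Summit.BirchSwinnertonDyer.BirchSwinnertonDyer.Theorems.MultThreeWinding
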